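import Summits.Ventures.CertifiedArithmetic.LowPrec.DoubleRoundingProductUnderflow
import Summits.Ventures.CertifiedArithmetic.LowPrec.DoubleRoundingGmidBelow

/-!
# Double rounding of products: register ties above a midpoint (THEOREM N-mul-T)

HONEST FRAMING (venture CertifiedArithmetic / cell `pub-lowprec`): certified error envelopes and
provably optimal rounding/accumulation schemes for low-precision formats under stated cost models;
every table by two implementations; no hardware or vendor claims.

`DRMul φ ψ` (`DoubleRoundingProductUnderflow.lean`): one product in the register `ψ`, converted to
`φ`, is the correctly rounded product of `φ`.  The named `13 × 13` matrix
(`DoubleRoundingProductCells.lean`, `certs/enum/DOUBLE-ROUNDING-MUL.json`) has `12` failing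
EMBEDDED cells (`F_φ ⊆ F_ψ`); three are instances of record-generic laws already in the tree —
the precision strip (`not_drMul_strip`, e2m3 → binary8p5, binary8p5 → bfloat16) and THEOREM
N-mul-U (`not_drMul_of_underflow`, e5m2 → binary8p3f) —; the other nine (e3m2 → e5m2 / binary8p3 /
binary8p3f / e4m3 / binary8p4 / binary8p4f, e2m3 → e4m3 / binary8p4 / binary8p4f: registers of the
SAME precision or one digit more, sources too SHALLOW for N-mul-U) were so far closed only by
their tabulated witnesses.  This file proves the law behind them, for EVERY pair of records:

* §1 THEOREM N-mul-T (`not_drMul_of_register_tie`).  Let `q = quantum φ = 2^d · q'`,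
  `q' = quantum ψ`, `d ≥ 1`, `m_φ, m_ψ ≥ 1`.  If two data `a = oa·2^α·q`, `b = ob·2^β·q` of `φ`
  (`oa, ob < 2^P_φ`, in range, `α + β + 2 L_φ = k + L_ψ`) have `oa · ob = 2t + 1` with `t` EVEN and
  `2^m_ψ ≤ t < 2^(m_ψ+1)`, `(t+1)·2^(k+1) ≤ M_ψ` — the product `a·b = (2t+1)·2^k·q'` is a TIE of
  `ψ` in a normal binade of `ψ`, resolved to the even value `μ = t·2^(k+1)·q'` —, and
  `t·2^(k+2) = (2j+1)·2^d` with `j` EVEN, `j + 1 < 2^P_φ`, `j + 1 ≤ M_φ` — `μ = (j + 1/2)·q` is a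
  midpoint of `φ` in its finest zone whose even side is BELOW —, and `k < d`, then
  `fl_φ (fl_ψ (a·b)) = j·q ≠ (j+1)·q = fl_φ (a·b)`: `¬ DRMul φ ψ`.  No inclusion of the value sets
  and no relation between the precisions is assumed (the register may be less precise).
* §2 the two canonical families as boolean tests on records and the named matrix:
  `drMulTie9Test` (`3 · 3 = 9 = 2·4 + 1`, register precision `3`, `μ = q/2`, data
  `3·2^(m+bias-5)·q` and `3q`: `9q/16 ↦ q/2 ↦ 0`, directly `q`) holds on `15` named cells, `3`
  embedded (e3m2 → e5m2 / binary8p3 / binary8p3f: `3/16 · 3/16 = 9/256 ↦ 1/32 ↦ 0`, directly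
  `1/16`); `drMulTie21Test` (`3 · 7 = 21 = 2·10 + 1`, register precision `4`, `μ = 5q/2`, data
  `3·2^(m+bias-4)·q` and `7q`: `21q/8 ↦ 5q/2 ↦ 2q`, directly `3q`) holds on `8` named cells, `6`
  embedded (e3m2 → e4m3 / binary8p4 / binary8p4f: `3/8 · 7/16 = 21/128 ↦ 5/32 ↦ 1/8`, directly
  `3/16`; e2m3 → the same three: `3/8 · 7/8 = 21/64 ↦ 5/16 ↦ 1/4`, directly `3/8`).  With these
  two tests every failing embedded named cell is an instance of a record-generic law
  (`DoubleRoundingProductMatrix.lean`, `drMul_named_failing_classified`).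

Two implementations: A = `code/enum/mul_matrix_laws.py` (exact rationals, two RNE
implementations: the generic hypotheses of §1 on pseudo-records `P_φ ≤ 6`, `P_ψ ≤ 7`, `d ≤ 8`,
shallow and deep, tight and roomy ranges — `17 782` instances, all slip with the three predicted
values; the two tests on pseudo-records, `2 879` cells; the `13 × 13` named cells) →
`certs/enum/DOUBLE-ROUNDING-MUL-MATRIX.json`; B = the kernel (this file).  PLACEMENT — KNOWN:
harmful double rounding of products through a register of EQUAL precision and WIDER exponent
range below the normal range of the target is the classical "double-rounding on underflow" of
the x87 in double-precision mode ([Monniaux2007, §3.1.2]: "exhibited by × and /, not by + and -";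
Shudo-Muraoka 2000, §3.2, Fig. 2), excluded by the hypotheses `e_min₂ ≤ 2 e_min₁` of the
innocuous-double-rounding theorems ([Figueroa1995, §3]; [Roux2014, §4]) and avoided by rounding
to odd ([BoldoMelquiond2008]).  We found no statement in print of this two-parameter tie family
or of which low-precision register pairs it decides (searches listed in
`DoubleRoundingProductMatrix.lean`).  NEW here: the law as a kernel theorem for every pair of
records, and its named instances.  No hardware or vendor claims.
-/

namespace Summit.Ventures.CertifiedArithmetic

open Literature.ComputerArithmetic.FloatingPoint
open Literature.ComputerArithmetic.FloatingPoint.Format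
open Literature.ComputerArithmetic.FloatingPoint.MiniFloat

/-! ## §1 THEOREM N-mul-T: a register tie just above a midpoint of `φ` slips -/

/-- THEOREM N-mul-T (REGISTER TIES) — for EVERY pair of format records, `q = quantum φ = 2^d·q'`,
`q' = quantum ψ`, `d ≥ 1`, `m_φ, m_ψ ≥ 1`: data `a = oa·2^α·q`, `b = ob·2^β·q` of `φ`
(`oa, ob < 2^P_φ`, in range) with `α + β + 2 L_φ = k + L_ψ` (so `a·b = oa·ob·2^k·q'`),
`oa·ob = 2t + 1`, `t` even, `2^m_ψ ≤ t < 2^(m_ψ+1)`, `(t+1)·2^(k+1) ≤ M_ψ` (the product is a tie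
of `ψ` in a normal binade, spacing `2^(k+1)·q'`, resolved to the EVEN value `μ = t·2^(k+1)·q'`),
`t·2^(k+2) = (2j+1)·2^d`, `j` even, `j + 1 < 2^P_φ`, `j + 1 ≤ M_φ` (`μ = (j + 1/2)·q`, a midpoint
of `φ` between the consecutive data `j·q` (even) and `(j+1)·q`), `k < d` (`a·b - μ = 2^k·q' < q/2`)
`⟹ ¬ DRMul φ ψ`: `fl_ψ (a·b) = μ`, `fl_φ μ = j·q` (tie to even) while `fl_φ (a·b) = (j+1)·q`.
[this packet; cite: Monniaux2007, §3.1.2; cite: Figueroa1995, §3; cite: Roux2014, §4] -/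
theorem not_drMul_of_register_tie {φ ψ : Format} (hq : ψ.qexp + 1 ≤ φ.qexp)
    (h1 : 1 ≤ φ.manBits) (h1' : 1 ≤ ψ.manBits) {oa ob α β k t j : ℕ}
    (hoa : oa < 2 ^ (φ.manBits + 1)) (hob : ob < 2 ^ (φ.manBits + 1))
    (ha : oa * 2 ^ α ≤ φ.maxScaled) (hb : ob * 2 ^ β ≤ φ.maxScaled)
    (hexp : ((α + β : ℕ) : ℤ) + 2 * φ.qexp = (k : ℤ) + ψ.qexp)
    (hK : oa * ob = 2 * t + 1) (ht : Even t) (htlo : 2 ^ ψ.manBits ≤ t)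
    (hthi : t < 2 ^ (ψ.manBits + 1)) (hu : (t + 1) * 2 ^ (k + 1) ≤ ψ.maxScaled)
    (hμ : t * 2 ^ (k + 2) = (2 * j + 1) * 2 ^ (φ.qexp - ψ.qexp).toNat)
    (hj : Even j) (hjm : j + 1 < 2 ^ (φ.manBits + 1)) (hjM : j + 1 ≤ φ.maxScaled)
    (hk : k + 1 ≤ (φ.qexp - ψ.qexp).toNat) : ¬ DRMul φ ψ := by
  intro hD
  have hq0 := φ.quantum_pos
  have hq1 := ψ.quantum_pos
  set d := (φ.qexp - ψ.qexp).toNat with hd'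
  have hQ : φ.quantum = 2 ^ d * ψ.quantum := quantum_eq_two_pow_mul (by omega)
  -- data
  obtain ⟨a, ha'⟩ := exists_toRat_eq_natMul (representable_mul_pow (φ := φ) hoa ha)
  obtain ⟨b, hb'⟩ := exists_toRat_eq_natMul (representable_mul_pow (φ := φ) hob hb)
  -- the unit: `2^α · 2^β · q² = 2^k · q'`
  have hunit : (2 : ℚ) ^ α * 2 ^ β * (φ.quantum * φ.quantum) = 2 ^ k * ψ.quantum := by
    have e : ((k : ℕ) : ℤ) + ψ.qexp = ((α : ℕ) : ℤ) + ((β : ℕ) : ℤ) + (φ.qexp + φ.qexp) := by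
      push_cast at hexp ⊢; omega
    have h2 : (2 : ℚ) ≠ 0 := by norm_num
    have eR : (2 : ℚ) ^ k * ψ.quantum = 2 ^ (((k : ℕ) : ℤ) + ψ.qexp) := by
      unfold Format.quantum; rw [zpow_add₀ h2, zpow_natCast]
    have eL : (2 : ℚ) ^ α * 2 ^ β * (φ.quantum * φ.quantum)
        = 2 ^ (((α : ℕ) : ℤ) + ((β : ℕ) : ℤ) + (φ.qexp + φ.qexp)) := by
      unfold Format.quantum
      rw [zpow_add₀ h2, zpow_add₀ h2, zpow_add₀ h2, zpow_natCast, zpow_natCast]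
    rw [eL, eR, e]
  -- the product `a·b = (2t+1)·2^k·q'`
  have hprod : a.toRat * b.toRat = (((2 * t + 1) * 2 ^ k : ℕ) : ℚ) * ψ.quantum := by
    have hK' : (oa : ℚ) * ob = 2 * t + 1 := by exact_mod_cast hK
    rw [ha', hb']
    push_cast
    calc (oa : ℚ) * 2 ^ α * φ.quantum * ((ob : ℚ) * 2 ^ β * φ.quantum)
        = (oa : ℚ) * ob * (2 ^ α * 2 ^ β * (φ.quantum * φ.quantum)) := by ring
      _ = (2 * t + 1) * (2 ^ k * ψ.quantum) := by rw [hK', hunit]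
      _ = (2 * t + 1) * 2 ^ k * ψ.quantum := by ring
  -- the register rounds the tie to the even value `μ = t·2^(k+1)·q'`
  have hY := toRat_roundNE_gmid (φ := ψ) (k := k) h1' ht htlo hthi hu
  -- `μ = (j + 1/2)·q`
  have hμ' : ((t * 2 ^ (k + 1) : ℕ) : ℚ) * ψ.quantum = ((2 * j + 1 : ℕ) : ℚ) / 2 * φ.quantum := by
    have e : (t : ℚ) * 2 ^ (k + 2) = (2 * j + 1) * 2 ^ d := by exact_mod_cast hμ
    rw [pow_succ] at e
    rw [hQ]
    push_cast
    linear_combination (ψ.quantum / 2) * e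
  -- `a·b = (j+1)·q + (2^k·q' - q/2)` with `|2^k·q' - q/2| < q/2`
  have hx : (((2 * t + 1) * 2 ^ k : ℕ) : ℚ) * ψ.quantum
      = ((j + 1 : ℕ) : ℚ) * φ.quantum + (2 ^ k * ψ.quantum - φ.quantum / 2) := by
    have e : (((2 * t + 1) * 2 ^ k : ℕ) : ℚ) * ψ.quantum
        = ((t * 2 ^ (k + 1) : ℕ) : ℚ) * ψ.quantum + 2 ^ k * ψ.quantum := by
      push_cast; ring
    rw [e, hμ']
    push_cast
    ring
  have hsmall : 2 * |(2 : ℚ) ^ k * ψ.quantum - φ.quantum / 2| < φ.quantum := by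
    have h2 : (2 : ℚ) ^ (k + 1) ≤ 2 ^ d := pow_le_pow_right₀ (by norm_num) hk
    have hle : 2 * ((2 : ℚ) ^ k * ψ.quantum) ≤ φ.quantum := by
      rw [hQ, ← mul_assoc, ← pow_succ']
      exact mul_le_mul_of_nonneg_right h2 hq1.le
    have hpos : 0 < (2 : ℚ) ^ k * ψ.quantum := by positivity
    rw [abs_of_nonpos (by linarith)]
    linarith
  have hX2 : (roundNE φ ((((2 * t + 1) * 2 ^ k : ℕ) : ℚ) * ψ.quantum)).toRat
      = ((j + 1 : ℕ) : ℚ) * φ.quantum := by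
    rw [hx]
    exact toRat_roundNE_natMul_add_small (representable_of_lt_pow hjm hjM) hsmall
  have key := hD a b
  rw [hprod, hY, hμ', toRat_roundNE_half_of_even h1 hj hjm hjM, hX2] at key
  push_cast at key
  have := mul_right_cancel₀ hq0.ne' key
  linarith

/-! ## §2 The two canonical families as boolean tests; the named records -/

/-- FAMILY `9 = 3 · 3` AS A BOOLEAN TEST on records: register precision `3` (`m_Y = 2`),
`d = L_X - L_Y ≥ 4`, `m_X ≥ 1`, depth `m_X + bias_X ≥ 5`, the data `3·2^(m+bias-5)` and `3` quanta
of `X` in range, `5·2^(d-3) ≤ M_Y`; then `a·b = 9q/16 = 9·2^(d-4)·q'`, a tie of `Y` above `q/2`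
(`t = 4`, `k = d - 4`, `j = 0`): `9q/16 ↦ q/2 ↦ 0`, directly `q`. [this packet] -/
def drMulTie9Test (X Y : Format) : Bool :=
  let d := (X.qexp - Y.qexp).toNat
  decide (Y.manBits = 2) && decide (1 ≤ X.manBits) && decide (Y.qexp + 4 ≤ X.qexp) &&
  decide (5 ≤ X.manBits + X.bias) && decide (3 * 2 ^ (X.manBits + X.bias - 5) ≤ X.maxScaled) &&
  decide (3 ≤ X.maxScaled) && decide (5 * 2 ^ (d - 3) ≤ Y.maxScaled)

/-- FAMILY `21 = 3 · 7` AS A BOOLEAN TEST on records: register precision `4` (`m_Y = 3`),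
`d = L_X - L_Y ≥ 3`, `m_X ≥ 2`, depth `m_X + bias_X ≥ 4`, the data `3·2^(m+bias-4)` and `7`
quanta of `X` in range, `11·2^(d-2) ≤ M_Y`; then `a·b = 21q/8 = 21·2^(d-3)·q'`, a tie of `Y`
above `5q/2` (`t = 10`, `k = d - 3`, `j = 2`): `21q/8 ↦ 5q/2 ↦ 2q`, directly `3q`.
[this packet] -/
def drMulTie21Test (X Y : Format) : Bool :=
  let d := (X.qexp - Y.qexp).toNat
  decide (Y.manBits = 3) && decide (2 ≤ X.manBits) && decide (Y.qexp + 3 ≤ X.qexp) &&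
  decide (4 ≤ X.manBits + X.bias) && decide (3 * 2 ^ (X.manBits + X.bias - 4) ≤ X.maxScaled) &&
  decide (7 ≤ X.maxScaled) && decide (11 * 2 ^ (d - 2) ≤ Y.maxScaled)

/-- SOUNDNESS: `drMulTie9Test X Y ⟹ ¬ DRMul X Y` (THEOREM N-mul-T at `oa = ob = 3`, `t = 4`,
`j = 0`, `k = d - 4`, `α = m + bias - 5`, `β = 0`). [this packet] -/
theorem not_drMul_of_tie9Test {X Y : Format} (h : drMulTie9Test X Y = true) : ¬ DRMul X Y := by
  simp only [drMulTie9Test, Bool.and_eq_true, decide_eq_true_eq] at h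
  obtain ⟨⟨⟨⟨⟨⟨hmY, h1⟩, hd⟩, hdepth⟩, ha⟩, hb⟩, hy⟩ := h
  obtain ⟨D, hD⟩ : ∃ D, (X.qexp - Y.qexp).toNat = D + 4 := ⟨(X.qexp - Y.qexp).toNat - 4, by omega⟩
  rw [hD, show D + 4 - 3 = D + 1 by omega] at hy
  have hoa : 3 < 2 ^ (X.manBits + 1) :=
    lt_of_lt_of_le (by norm_num) (Nat.pow_le_pow_right (by norm_num) (by omega) : 2 ^ 2 ≤ _)
  have hexp : ((X.manBits + X.bias - 5 + 0 : ℕ) : ℤ) + 2 * X.qexp = ((D : ℕ) : ℤ) + Y.qexp := by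
    have e1 : X.qexp = 1 - (X.bias : ℤ) - X.manBits := rfl
    have e2 : Y.qexp = 1 - (Y.bias : ℤ) - Y.manBits := rfl
    push_cast
    omega
  exact not_drMul_of_register_tie (by omega) h1 (by omega) (t := 4) (j := 0) hoa hoa ha
    (by simpa using hb) hexp (by norm_num) ⟨2, rfl⟩ (by rw [hmY]; norm_num) (by rw [hmY]; norm_num)
    (by simpa using hy) (by rw [hD]; ring) ⟨0, rfl⟩ (by omega) (by omega) (by omega)

/-- SOUNDNESS: `drMulTie21Test X Y ⟹ ¬ DRMul X Y` (THEOREM N-mul-T at `oa = 3`, `ob = 7`,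
`t = 10`, `j = 2`, `k = d - 3`, `α = m + bias - 4`, `β = 0`). [this packet] -/
theorem not_drMul_of_tie21Test {X Y : Format} (h : drMulTie21Test X Y = true) :
    ¬ DRMul X Y := by
  simp only [drMulTie21Test, Bool.and_eq_true, decide_eq_true_eq] at h
  obtain ⟨⟨⟨⟨⟨⟨hmY, h2⟩, hd⟩, hdepth⟩, ha⟩, hb⟩, hy⟩ := h
  obtain ⟨D, hD⟩ : ∃ D, (X.qexp - Y.qexp).toNat = D + 3 := ⟨(X.qexp - Y.qexp).toNat - 3, by omega⟩
  rw [hD, show D + 3 - 2 = D + 1 by omega] at hy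
  have hoa : 3 < 2 ^ (X.manBits + 1) :=
    lt_of_lt_of_le (by norm_num) (Nat.pow_le_pow_right (by norm_num) (by omega) : 2 ^ 2 ≤ _)
  have hob : 7 < 2 ^ (X.manBits + 1) :=
    lt_of_lt_of_le (by norm_num) (Nat.pow_le_pow_right (by norm_num) (by omega) : 2 ^ 3 ≤ _)
  have hexp : ((X.manBits + X.bias - 4 + 0 : ℕ) : ℤ) + 2 * X.qexp = ((D : ℕ) : ℤ) + Y.qexp := by
    have e1 : X.qexp = 1 - (X.bias : ℤ) - X.manBits := rfl
    have e2 : Y.qexp = 1 - (Y.bias : ℤ) - Y.manBits := rfl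
    push_cast
    omega
  exact not_drMul_of_register_tie (by omega) (by omega) (by omega) (t := 10) (j := 2) hoa hob ha
    (by simpa using hb) hexp (by norm_num) ⟨5, rfl⟩ (by rw [hmY]; norm_num) (by rw [hmY]; norm_num)
    (by simpa using hy) (by rw [hD]; ring) ⟨1, rfl⟩ (by omega) (by omega) (by omega)

/-- ON THE NAMED `13 × 13` MATRIX the `9`-test holds on exactly `15` cells: the sources of depth
`m + bias ≥ 5` above the precision-`3` registers e5m2, binary8p3, binary8p3f at `d ≥ 4` — e3m2
(the `3` embedded cells) and e4m3, binary8p4, binary8p5, binary8p4f (registers LESS precise than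
the source; not embedded). [this packet] -/
theorem drMulTie9_named_iff : ∀ X ∈ namedFormats, ∀ Y ∈ namedFormats,
    drMulTie9Test X Y = true ↔ (X, Y) ∈
      [(E3M2, E5M2), (E3M2, Binary8p3), (E3M2, Binary8p3F), (E4M3, E5M2), (E4M3, Binary8p3),
        (E4M3, Binary8p3F), (Binary8p4, E5M2), (Binary8p4, Binary8p3), (Binary8p4, Binary8p3F),
        (Binary8p5, E5M2), (Binary8p5, Binary8p3), (Binary8p5, Binary8p3F), (Binary8p4F, E5M2),
        (Binary8p4F, Binary8p3), (Binary8p4F, Binary8p3F)] := by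
  decide +kernel

/-- ON THE NAMED `13 × 13` MATRIX the `21`-test holds on exactly `8` cells: e3m2 and e2m3 above
the precision-`4` registers e4m3, binary8p4, binary8p4f (the `6` embedded cells) and binary8p5 →
binary8p4 / binary8p4f (not embedded). [this packet] -/
theorem drMulTie21_named_iff : ∀ X ∈ namedFormats, ∀ Y ∈ namedFormats,
    drMulTie21Test X Y = true ↔ (X, Y) ∈
      [(E3M2, E4M3), (E3M2, Binary8p4), (E3M2, Binary8p4F), (E2M3, E4M3), (E2M3, Binary8p4),
        (E2M3, Binary8p4F), (Binary8p5, Binary8p4), (Binary8p5, Binary8p4F)] := by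
  decide +kernel

/-- AMONG THE `23` TIE CELLS exactly `9` are embedded pairs (`F_X ⊆ F_Y`): the two tests never
hold together, and the embedded ones are e3m2 → e5m2 / binary8p3 / binary8p3f / e4m3 / binary8p4 /
binary8p4f and e2m3 → e4m3 / binary8p4 / binary8p4f. [this packet] -/
theorem drMulTie_named_embedded : ∀ X ∈ namedFormats, ∀ Y ∈ namedFormats,
    (drMulTie9Test X Y || drMulTie21Test X Y) = true →
      ¬ (drMulTie9Test X Y = true ∧ drMulTie21Test X Y = true) ∧
      (embedsTest X Y = true ↔ (X, Y) ∈
        [(E3M2, E4M3), (E3M2, E5M2), (E3M2, Binary8p3), (E3M2, Binary8p4), (E3M2, Binary8p3F),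
          (E3M2, Binary8p4F), (E2M3, E4M3), (E2M3, Binary8p4), (E2M3, Binary8p4F)]) := by
  decide +kernel

/-- THE `9` EMBEDDED TIE CELLS FAIL BY THE LAW: each is an embedded pair and `¬ DRMul` by
`not_drMul_of_tie9Test` / `not_drMul_of_tie21Test` — e3m2 → e5m2 / binary8p3 / binary8p3f at
`3/16 · 3/16 = 9/256 ↦ 1/32 ↦ 0`, directly `1/16`; e3m2 → e4m3 / binary8p4 / binary8p4f at
`3/8 · 7/16 = 21/128 ↦ 5/32 ↦ 1/8`, directly `3/16`; e2m3 → e4m3 / binary8p4 / binary8p4f at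
`3/8 · 7/8 = 21/64 ↦ 5/16 ↦ 1/4`, directly `3/8` (the cells' first witnesses in
`DoubleRoundingProductCells.lean` are other members of the same families). [this packet] -/
theorem drMulTie_cells : ∀ p ∈ [(E3M2, E4M3), (E3M2, E5M2), (E3M2, Binary8p3), (E3M2, Binary8p4),
    (E3M2, Binary8p3F), (E3M2, Binary8p4F), (E2M3, E4M3), (E2M3, Binary8p4), (E2M3, Binary8p4F)],
    embedsTest p.1 p.2 = true ∧ ¬ DRMul p.1 p.2 := by
  intro p hp
  simp only [List.mem_cons, List.not_mem_nil, or_false] at hp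
  rcases hp with rfl | rfl | rfl | rfl | rfl | rfl | rfl | rfl | rfl
  all_goals first
    | exact ⟨by decide +kernel, not_drMul_of_tie9Test (by decide +kernel)⟩
    | exact ⟨by decide +kernel, not_drMul_of_tie21Test (by decide +kernel)⟩

/-- READING (numbers of the three embedded rows). -/
example : (roundNE E3M2 (roundNE E5M2 (3 / 16 * (3 / 16))).toRat).toRat = 0 ∧
    (roundNE E3M2 (3 / 16 * (3 / 16) : ℚ)).toRat = 1 / 16 ∧
    (roundNE E3M2 (roundNE E4M3 (3 / 8 * (7 / 16))).toRat).toRat = 1 / 8 ∧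
    (roundNE E3M2 (3 / 8 * (7 / 16) : ℚ)).toRat = 3 / 16 ∧
    (roundNE E2M3 (roundNE Binary8p4 (3 / 8 * (7 / 8))).toRat).toRat = 1 / 4 ∧
    (roundNE E2M3 (3 / 8 * (7 / 8) : ℚ)).toRat = 3 / 8 := by
  decide +kernel

/-- READING (no inclusion needed): e4m3 products through the LESS precise e5m2 also slip by the
law: the family data are `3·2^(m+bias-5)·q = 3/16` and `3q = 3/512` (`q = 2^-9`), with
`3/16 · 3/512 = 9/8192 = 9q/16 ↦ q/2 = 2^-10 ↦ 0`, directly `q = 2^-9` (numbers kernel-checked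
below; erratum to the first landing's docstring, referee NIT-40). -/
example : ¬ DRMul E4M3 E5M2 := not_drMul_of_tie9Test (by decide +kernel)

example : (3 / 16 * (3 / 512) : ℚ) = 9 / 8192 ∧
    (roundNE E5M2 (3 / 16 * (3 / 512) : ℚ)).toRat = 1 / 1024 ∧
    (roundNE E4M3 (roundNE E5M2 (3 / 16 * (3 / 512))).toRat).toRat = 0 ∧
    (roundNE E4M3 (3 / 16 * (3 / 512) : ℚ)).toRat = 1 / 512 := by
  refine ⟨by norm_num, ?_⟩
  decide +kernel

end Summit.Ventures.CertifiedArithmetic
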